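import Summits.ResolutionOfSingularities.ResolutionOfSingularities.Theorems.EquisingularLiftCampaignW45bAvoidBadPoint
import Mathlib.RingTheory.Localization.AtPrime.Basic
import Mathlib.RingTheory.PrincipalIdealDomain
import Mathlib.Algebra.Polynomial.FieldDivision
import HarnessLib

/-!
# [OURS · L1 W4.5(b)] T-ΔMULT engine — strict transforms in the `w`-chart, orders in `κ[X]_𝔮`, reduction to the exceptional line

Crux chain w45b, crux EL♮ = `Theses.EquisingularLift.EquisingularLiftNat` (stmt-ResolutionOfSingularities-20038), stub
`stub_elnat_three_isolated`; ENGINE for target **T-ΔMULT** of res-L1-w45b-lead-2 (2026-08-27 «multiplicity does not rise in the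
REGULAR chart of a Δ/COMB step at an equimultiple point»), consumed by `…CampaignW45bDeltaMultiplicity.lean`. OURS; NOT a statement
of any manuscript; AI-written, weaker than expert review. `--supports stmt-ResolutionOfSingularities-20038 --as helper`.
Pure commutative algebra, each ring as general as the statement allows:
* §1 `exists_polynomial_of_mem_span_pair_pow` — `y ∈ (e,w)^ν ⇒ y = Σ_{j≤ν} p_j e^j w^{ν-j}`, `p ∈ R[X]`, `deg p ≤ ν` (any ring);
* §2 `divPow_eq_aeval_gen_wChart` — in the `w`-chart `B′ = R[(e,w)/w] ⊆ R[1/w]` (tree `blowupAlgebra`): `y/w^ν = p(e/w)`;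
* §3 `isUnit_coeff_of_eq_sum_of_notMem_pow` — `R` local, `e ∈ 𝔪`, `w ∈ 𝔪²`, `y ∉ 𝔪^{ν+1}` ⇒ `p_ν` is a UNIT
  (`e^j w^{ν-j} ∈ 𝔪^{2ν-j} ⊆ 𝔪^{ν+1}`, `j < ν`), so `p̄ ∈ κ[X]` is nonzero of degree exactly `ν`;
* §4 `le_natDegree_of_algebraMap_mem_pow` — over a field, `0 ≠ P ∈ (𝔮κ[X]_𝔮)^n` (ANY prime `𝔮`) only if `n ≤ deg P`;
  `eq_span_X_sub_C_of_algebraMap_mem_pow_natDegree` — `n = deg P ≥ 1` forces `𝔮 = (X − a₀)` and `P = lc · (X − a₀)^{deg P}`;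
* §5 reduction engine — for `B = R[t]` and `ρ : B → κ[X]` with `ρ(p(t)) = p̄` (the tree's `exists_ringHom_polynomial_residueField`,
  p504673, gives it on blow-up charts): `ker ρ = 𝔪B`, primes `𝔓 ⊇ 𝔪B` ↔ primes `ρ(𝔓)` of `κ[X]` (`comap_map_reduction`), ORDERS
  ONLY GROW under the local map `B_𝔓 → κ[X]_{ρ(𝔓)}` (`algebraMap_reduction_mem_pow`), rational points `ρ⁻¹((X − c̄)) = 𝔪B + (t − c)`
  are maximal (`comap_reduction_span_X_sub_C`, `isMaximal_map_sup_span_gen_sub`).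
References: res-L1-w45b-lead-2 STATUS 2026-08-27T06:04:05Z «T-ΔMULT», LEAD-MEMO-1 §4 (OURS planning texts); Q. Liu (2002) §8.1;
V. Cossart, U. Jannsen, S. Saito, LNM 2270 (2020), §2 — context only.
-/

noncomputable section

set_option linter.dupNamespace false -- mandated namespace `Summit.<Summit>.<Problem>` of this single-conjunct summit

open IsLocalRing IsLocalization Polynomial
open Literature.AlgebraicGeometry.Resolution

namespace Summit.ResolutionOfSingularities.ResolutionOfSingularities.Cruxes.EquisingularLiftNat.Sections

universe u

/-! ## §1 Monomial presentation of `(e, w)^ν` -/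

section Presentation

variable {R : Type u} [CommRing R] (e w : R)

/-- `e ∈ (e, w)`. [folklore] -/
theorem mem_span_pair_left : e ∈ Ideal.span ({e, w} : Set R) :=
  Ideal.subset_span (by simp)

/-- **`(e, w)^ν` is spanned by the monomials `e^j w^{ν-j}`**: every `y ∈ (e, w)^ν` is
`y = Σ_{j ≤ ν} p_j e^j w^{ν-j}` for a polynomial `p = Σ p_j X^j ∈ R[X]` of degree `≤ ν`
(any commutative ring). [folklore] -/
theorem exists_polynomial_of_mem_span_pair_pow :
    ∀ (ν : ℕ) {y : R}, y ∈ Ideal.span {e, w} ^ ν →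
      ∃ p : R[X], p.natDegree ≤ ν ∧
        y = ∑ j ∈ Finset.range (ν + 1), p.coeff j * e ^ j * w ^ (ν - j) := by
  intro ν
  induction ν with
  | zero =>
    intro y _
    exact ⟨C y, by simp, by simp⟩
  | succ ν ih =>
    intro y hy
    obtain ⟨c, r, hr, rfl⟩ := exists_eq_mul_pow_add_mul_of_mem_span_pair_pow e w (ν + 1) hy
    rw [Nat.add_sub_cancel] at hr
    obtain ⟨q, hq, hrq⟩ := ih hr
    refine ⟨q + C c * X ^ (ν + 1), ?_, ?_⟩
    · refine (natDegree_add_le _ _).trans (max_le (hq.trans (Nat.le_succ ν)) ?_)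
      exact natDegree_C_mul_X_pow_le c (ν + 1)
    · have hqν : q.coeff (ν + 1) = 0 := coeff_eq_zero_of_natDegree_lt (Nat.lt_succ_of_le hq)
      rw [Finset.sum_range_succ, hrq, Finset.mul_sum]
      simp only [coeff_add, coeff_C_mul_X_pow, hqν, if_true, zero_add, Nat.sub_self, pow_zero, mul_one]
      rw [add_comm]
      congr 1
      refine Finset.sum_congr rfl fun j hj => ?_
      have hjν : j ≤ ν := Nat.lt_succ_iff.mp (Finset.mem_range.mp hj)
      have hne : j ≠ ν + 1 := by omega
      rw [if_neg hne, add_zero, show ν + 1 - j = (ν - j) + 1 by omega, pow_succ]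
      ring

end Presentation

/-! ## §2 The `w`-chart `B′ = R[(e,w)/w] = R[a]`, `a = e/w`, and the strict transform `y/w^ν = p(a)` -/

section WChartIdentity

variable {R : Type u} [CommRing R] (e w : R)

/-- **Strict transform in the `w`-chart.** If `y = Σ_{j ≤ ν} p_j e^j w^{ν-j}` then in
`B′ = R[(e,w)/w] ⊆ R[1/w]` the strict transform `y/w^ν` is the polynomial `p(a)` in the chart
coordinate `a = e/w`. [folklore] -/
theorem divPow_eq_aeval_gen_wChart {ν : ℕ} {y : R} (hy : y ∈ Ideal.span {e, w} ^ ν) (p : R[X])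
    (hp : p.natDegree ≤ ν)
    (hyp : y = ∑ j ∈ Finset.range (ν + 1), p.coeff j * e ^ j * w ^ (ν - j)) :
    blowupAlgebra.divPow (Ideal.span {e, w}) w hy =
      Polynomial.aeval (blowupAlgebra.gen (Ideal.span {e, w}) w e (mem_span_pair_left e w)) p := by
  set t := blowupAlgebra.gen (Ideal.span {e, w}) w e (mem_span_pair_left e w)
  apply Subtype.ext
  have hcoe : ((Polynomial.aeval t p : blowupAlgebra (Ideal.span {e, w}) w) : Localization.Away w) =
      Polynomial.aeval (t : Localization.Away w) p :=
    (Polynomial.aeval_algHom_apply (blowupAlgebra (Ideal.span {e, w}) w).val t p).symm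
  rw [hcoe, Polynomial.aeval_eq_sum_range' (Nat.lt_succ_of_le hp), blowupAlgebra.coe_divPow, hyp, map_sum,
    Finset.sum_mul]
  refine Finset.sum_congr rfl fun j hj => ?_
  have hjν : j ≤ ν := Nat.lt_succ_iff.mp (Finset.mem_range.mp hj)
  rw [Algebra.smul_def, blowupAlgebra.coe_gen, map_mul, map_mul, map_pow, map_pow, mul_pow]
  -- `w^{ν-j} · (1/w)^ν = (1/w)^j`
  have hsplit : (Away.invSelf w : Localization.Away w) ^ ν =
      (Away.invSelf w : Localization.Away w) ^ (ν - j) * (Away.invSelf w : Localization.Away w) ^ j := by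
    rw [← pow_add, Nat.sub_add_cancel hjν]
  have hcancel : algebraMap R (Localization.Away w) w ^ (ν - j) *
      (Away.invSelf w : Localization.Away w) ^ (ν - j) = 1 := by
    rw [← mul_pow, Away.mul_invSelf, one_pow]
  rw [hsplit]
  linear_combination (algebraMap R (Localization.Away w) (p.coeff j) *
    algebraMap R (Localization.Away w) e ^ j * (Away.invSelf w : Localization.Away w) ^ j) * hcancel

end WChartIdentity

/-! ## §3 The leading coefficient is a unit (local ring, `e ∈ 𝔪`, `w ∈ 𝔪²`, `y ∉ 𝔪^{ν+1}`) -/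

section LeadingUnit

variable {R : Type u} [CommRing R] [IsLocalRing R] {e w : R}

/-- The lower monomials lie deep: `e^j w^{ν-j} ∈ 𝔪^{2ν-j} ⊆ 𝔪^{ν+1}` for `j < ν`, `e ∈ 𝔪`, `w ∈ 𝔪²`.
[folklore] -/
theorem pow_mul_pow_mem_pow_succ (he : e ∈ maximalIdeal R) (hw : w ∈ maximalIdeal R ^ 2) {ν j : ℕ}
    (hj : j < ν) : e ^ j * w ^ (ν - j) ∈ maximalIdeal R ^ (ν + 1) := by
  have h1 : e ^ j ∈ maximalIdeal R ^ j := Ideal.pow_mem_pow he j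
  have h2 : w ^ (ν - j) ∈ maximalIdeal R ^ (2 * (ν - j)) := by
    rw [pow_mul]; exact Ideal.pow_mem_pow hw _
  have h3 : e ^ j * w ^ (ν - j) ∈ maximalIdeal R ^ (j + 2 * (ν - j)) := by
    rw [pow_add]; exact Ideal.mul_mem_mul h1 h2
  exact Ideal.pow_le_pow_right (by omega) h3

/-- **The AVOID unit.** If `y = Σ_{j ≤ ν} p_j e^j w^{ν-j}` with `e ∈ 𝔪`, `w ∈ 𝔪²` and `y ∉ 𝔪^{ν+1}`
(multiplicity exactly `ν` at the closed point), then the top coefficient `p_ν` is a UNIT: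
`y ≡ p_ν e^ν (mod 𝔪^{ν+1})`. [folklore; res-L1-w45b-lead-2 T-ΔMULT (OURS)] -/
theorem isUnit_coeff_of_eq_sum_of_notMem_pow (he : e ∈ maximalIdeal R) (hw : w ∈ maximalIdeal R ^ 2)
    {ν : ℕ} {y : R} (p : R[X])
    (hyp : y = ∑ j ∈ Finset.range (ν + 1), p.coeff j * e ^ j * w ^ (ν - j))
    (hy' : y ∉ maximalIdeal R ^ (ν + 1)) : IsUnit (p.coeff ν) := by
  by_contra hu
  apply hy'
  rw [hyp]
  refine Ideal.sum_mem _ fun j hj => ?_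
  rcases (Nat.lt_succ_iff.mp (Finset.mem_range.mp hj)).lt_or_eq with hjν | rfl
  · rw [mul_assoc]; exact Ideal.mul_mem_left _ _ (pow_mul_pow_mem_pow_succ he hw hjν)
  · rw [Nat.sub_self, pow_zero, mul_one, pow_succ']
    exact Ideal.mul_mem_mul ((mem_maximalIdeal _).mpr hu) (Ideal.pow_mem_pow he _)

/-- With a unit top coefficient the degree is exactly `ν`. [folklore] -/
theorem natDegree_eq_of_isUnit_coeff {ν : ℕ} {p : R[X]} (hp : p.natDegree ≤ ν) (hu : IsUnit (p.coeff ν)) :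
    p.natDegree = ν := le_antisymm hp (le_natDegree_of_ne_zero hu.ne_zero)

/-- The residue polynomial `p̄ ∈ κ[X]` then has degree exactly `ν` … [folklore] -/
theorem natDegree_map_residue_eq {ν : ℕ} {p : R[X]} (hp : p.natDegree ≤ ν) (hu : IsUnit (p.coeff ν)) :
    (p.map (residue R)).natDegree = ν := by
  have hν := natDegree_eq_of_isUnit_coeff hp hu
  have hlc : residue R p.leadingCoeff ≠ 0 := by
    rw [Polynomial.leadingCoeff, hν]; exact (hu.map (residue R)).ne_zero
  rw [natDegree_map_of_leadingCoeff_ne_zero _ hlc, hν]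

/-- … and is nonzero. [folklore] -/
theorem map_residue_ne_zero {ν : ℕ} {p : R[X]} (hu : IsUnit (p.coeff ν)) : p.map (residue R) ≠ 0 := by
  intro h
  have h1 : (p.map (residue R)).coeff ν = 0 := by rw [h, coeff_zero]
  rw [coeff_map] at h1
  exact (hu.map (residue R)).ne_zero h1

end LeadingUnit

/-! ## §4 Polynomials over a field: order of vanishing at a prime of `κ[X]` is bounded by the degree -/

section FieldEngine

variable {A : Type u} [CommRing A]

/-- Unwinding membership in a power of the maximal ideal of `A_𝔮`: `a/1 ∈ (𝔮A_𝔮)^n` iff `m a ∈ 𝔮^n`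
for some `m ∉ 𝔮` (one direction). [folklore] -/
theorem exists_mul_mem_pow_of_algebraMap_mem_pow (𝔮 : Ideal A) [𝔮.IsPrime] {a : A} {n : ℕ}
    (h : algebraMap A (Localization.AtPrime 𝔮) a ∈ maximalIdeal (Localization.AtPrime 𝔮) ^ n) :
    ∃ m ∉ 𝔮, m * a ∈ 𝔮 ^ n := by
  rw [← Localization.AtPrime.map_eq_maximalIdeal, ← Ideal.map_pow,
    IsLocalization.algebraMap_mem_map_algebraMap_iff 𝔮.primeCompl] at h
  obtain ⟨m, hm, hma⟩ := h
  exact ⟨m, hm, hma⟩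

variable {κ : Type u} [Field κ]

/-- **Order ≤ degree.** A NONZERO polynomial `P ∈ κ[X]` over a field lies in `(𝔮 κ[X]_𝔮)^n` for a
prime `𝔮` only if `n ≤ deg P`: for `𝔮 = (f)`, `f` irreducible, `f^n ∣ P` forces `n · deg f ≤ deg P`;
for `𝔮 = 0` only `n = 0` is possible. [folklore] -/
theorem le_natDegree_of_algebraMap_mem_pow (𝔮 : Ideal κ[X]) [𝔮.IsPrime] {P : κ[X]} (hP : P ≠ 0)
    {n : ℕ} (h : algebraMap κ[X] (Localization.AtPrime 𝔮) P ∈ maximalIdeal (Localization.AtPrime 𝔮) ^ n) :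
    n ≤ P.natDegree := by
  obtain ⟨m, hm, hmP⟩ := exists_mul_mem_pow_of_algebraMap_mem_pow 𝔮 h
  rcases Nat.eq_zero_or_pos n with rfl | hn
  · exact Nat.zero_le _
  by_cases hbot : 𝔮 = ⊥
  · subst hbot
    exfalso
    have hm0 : m ≠ 0 := fun h0 => hm (h0 ▸ Ideal.zero_mem _)
    rw [← Ideal.zero_eq_bot, zero_pow hn.ne', Ideal.zero_eq_bot, Ideal.mem_bot] at hmP
    exact hP ((mul_eq_zero.mp hmP).resolve_left hm0)
  · set f := Submodule.IsPrincipal.generator 𝔮 with hf_def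
    have hf : Prime f := Submodule.IsPrincipal.prime_generator_of_isPrime 𝔮 hbot
    have h𝔮 : 𝔮 = Ideal.span {f} := (Ideal.span_singleton_generator 𝔮).symm
    rw [h𝔮, Ideal.span_singleton_pow, Ideal.mem_span_singleton] at hmP
    have hfm : ¬ f ∣ m := fun hd => hm (h𝔮 ▸ Ideal.mem_span_singleton.mpr hd)
    have hfP : f ^ n ∣ P := hf.pow_dvd_of_dvd_mul_left n hfm hmP
    have hdeg : (f ^ n).natDegree ≤ P.natDegree := natDegree_le_of_dvd hfP hP
    rw [natDegree_pow] at hdeg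
    have hf1 : 1 ≤ f.natDegree :=
      natDegree_pos_iff_degree_pos.mpr (degree_pos_of_irreducible hf.irreducible)
    calc n = n * 1 := (mul_one n).symm
      _ ≤ n * f.natDegree := Nat.mul_le_mul_left n hf1
      _ ≤ P.natDegree := hdeg

/-- **Order = degree pins the point.** If moreover `n = deg P ≥ 1` then `𝔮 = (X − a₀)` is a RATIONAL
point and `P = c · (X − a₀)^{deg P}`, `c` the leading coefficient. [folklore] -/
theorem eq_span_X_sub_C_of_algebraMap_mem_pow_natDegree (𝔮 : Ideal κ[X]) [𝔮.IsPrime] {P : κ[X]}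
    (hP : P ≠ 0) (hν : 1 ≤ P.natDegree)
    (h : algebraMap κ[X] (Localization.AtPrime 𝔮) P ∈
      maximalIdeal (Localization.AtPrime 𝔮) ^ P.natDegree) :
    ∃ a₀ : κ, 𝔮 = Ideal.span {X - C a₀} ∧ P = C P.leadingCoeff * (X - C a₀) ^ P.natDegree := by
  set ν := P.natDegree with hν_def
  obtain ⟨m, hm, hmP⟩ := exists_mul_mem_pow_of_algebraMap_mem_pow 𝔮 h
  have hbot : 𝔮 ≠ ⊥ := by
    rintro rfl
    have hm0 : m ≠ 0 := fun h0 => hm (h0 ▸ Ideal.zero_mem _)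
    rw [← Ideal.zero_eq_bot, zero_pow (by omega), Ideal.zero_eq_bot, Ideal.mem_bot] at hmP
    exact hP ((mul_eq_zero.mp hmP).resolve_left hm0)
  set f := Submodule.IsPrincipal.generator 𝔮 with hf_def
  have hf : Prime f := Submodule.IsPrincipal.prime_generator_of_isPrime 𝔮 hbot
  have h𝔮 : 𝔮 = Ideal.span {f} := (Ideal.span_singleton_generator 𝔮).symm
  rw [h𝔮, Ideal.span_singleton_pow, Ideal.mem_span_singleton] at hmP
  have hfm : ¬ f ∣ m := fun hd => hm (h𝔮 ▸ Ideal.mem_span_singleton.mpr hd)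
  have hfP : f ^ ν ∣ P := hf.pow_dvd_of_dvd_mul_left ν hfm hmP
  -- `deg f = 1`
  have hdeg : (f ^ ν).natDegree ≤ P.natDegree := natDegree_le_of_dvd hfP hP
  rw [natDegree_pow] at hdeg
  have hf1 : 1 ≤ f.natDegree :=
    natDegree_pos_iff_degree_pos.mpr (degree_pos_of_irreducible hf.irreducible)
  have hf1' : f.natDegree = 1 := by
    refine le_antisymm ?_ hf1
    by_contra hlt
    have h2 : 2 ≤ f.natDegree := by omega
    have : ν * 2 ≤ ν := (Nat.mul_le_mul_left ν h2).trans hdeg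
    omega
  -- the root `a₀` of `f`
  obtain ⟨a₀, ha₀⟩ := exists_root_of_degree_eq_one ((degree_eq_iff_natDegree_eq hf.ne_zero).mpr hf1')
  have hXf : X - C a₀ ∣ f := dvd_iff_isRoot.mpr ha₀
  have hspan : Ideal.span {f} = Ideal.span {X - C a₀} := by
    obtain ⟨g, hg⟩ := hXf
    rw [Ideal.span_singleton_eq_span_singleton]
    rcases hf.irreducible.isUnit_or_isUnit hg with hu | hu
    · exact absurd hu (not_isUnit_X_sub_C a₀)
    · have hassoc : Associated (X - C a₀) f := ⟨hu.unit, by rw [IsUnit.unit_spec]; exact hg.symm⟩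
      exact hassoc.symm
  refine ⟨a₀, h𝔮.trans hspan, ?_⟩
  -- `(X − a₀)^ν ∣ P` with equal degrees
  have hXP : (X - C a₀) ^ ν ∣ P := (pow_dvd_pow_of_dvd hXf ν).trans hfP
  obtain ⟨g, hg⟩ := hXP
  have hg0 : g ≠ 0 := by rintro rfl; exact hP (by rw [hg, mul_zero])
  have hmon : ((X - C a₀) ^ ν).Monic := (monic_X_sub_C a₀).pow ν
  have hgdeg : g.natDegree = 0 := by
    have h1 : P.natDegree = ((X - C a₀) ^ ν).natDegree + g.natDegree := by
      rw [hg, natDegree_mul hmon.ne_zero hg0]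
    rw [(monic_X_sub_C a₀).natDegree_pow ν, natDegree_X_sub_C, mul_one] at h1
    omega
  have hglc : P.leadingCoeff = g.coeff 0 := by
    rw [hg, leadingCoeff_mul, hmon.leadingCoeff, one_mul, Polynomial.leadingCoeff, hgdeg]
  rw [hglc, mul_comm, ← eq_C_of_natDegree_eq_zero hgdeg]
  exact hg

end FieldEngine

/-! ## §5 Reduction to the exceptional line: transporting orders along `ρ : B → κ[X]` -/

section ReductionEngine

variable {R : Type u} [CommRing R] [IsLocalRing R] {B : Type u} [CommRing B] [Algebra R B] {t : B}
  {ρ : B →+* (ResidueField R)[X]}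

/-- `ρ(s) = s̄` on scalars. [folklore] -/
theorem reduction_algebraMap (hρ : ∀ p : R[X], ρ (Polynomial.aeval t p) = p.map (residue R)) (s : R) :
    ρ (algebraMap R B s) = C (residue R s) := by
  rw [← Polynomial.aeval_C t s, hρ, Polynomial.map_C]

/-- `ρ(t) = X`. [folklore] -/
theorem reduction_gen (hρ : ∀ p : R[X], ρ (Polynomial.aeval t p) = p.map (residue R)) : ρ t = X := by
  rw [← Polynomial.aeval_X (R := R) t, hρ, Polynomial.map_X]

/-- `ρ` is onto `κ[X]`. [folklore] -/
theorem reduction_surjective (hρ : ∀ p : R[X], ρ (Polynomial.aeval t p) = p.map (residue R)) :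
    Function.Surjective ρ := by
  intro P
  obtain ⟨p, rfl⟩ := Polynomial.map_surjective (residue R) residue_surjective P
  exact ⟨Polynomial.aeval t p, hρ p⟩

/-- **`ker ρ ⊆ 𝔪B`** when `B = R[t]`: a polynomial with all coefficients in `𝔪` evaluates into `𝔪B`. [folklore] -/
theorem ker_reduction_le (hsurj : Function.Surjective (Polynomial.aeval (R := R) t))
    (hρ : ∀ p : R[X], ρ (Polynomial.aeval t p) = p.map (residue R)) :
    RingHom.ker ρ ≤ (maximalIdeal R).map (algebraMap R B) := by
  intro z hz
  obtain ⟨p, rfl⟩ := hsurj z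
  rw [RingHom.mem_ker, hρ] at hz
  have hcoef : ∀ i, p.coeff i ∈ maximalIdeal R := fun i => by
    have h := congrArg (fun q : (ResidueField R)[X] => q.coeff i) hz
    simp only [coeff_map, coeff_zero] at h
    exact (residue_eq_zero_iff _).mp h
  rw [Polynomial.aeval_eq_sum_range]
  refine Ideal.sum_mem _ fun i _ => ?_
  rw [Algebra.smul_def]
  exact Ideal.mul_mem_right _ _ (Ideal.mem_map_of_mem _ (hcoef i))

/-- `𝔪B ⊆ ker ρ`. [folklore] -/
theorem map_maximalIdeal_le_ker_reduction (hρ : ∀ p : R[X], ρ (Polynomial.aeval t p) = p.map (residue R)) :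
    (maximalIdeal R).map (algebraMap R B) ≤ RingHom.ker ρ := by
  rw [Ideal.map_le_iff_le_comap]
  intro m hm
  rw [Ideal.mem_comap, RingHom.mem_ker, reduction_algebraMap hρ, (residue_eq_zero_iff m).mpr hm, map_zero]

/-- For a prime `𝔓 ⊇ 𝔪B` of `B`, its image `ρ(𝔓)` is a prime of `κ[X]` … [folklore] -/
theorem isPrime_map_reduction (hsurj : Function.Surjective (Polynomial.aeval (R := R) t))
    (hρ : ∀ p : R[X], ρ (Polynomial.aeval t p) = p.map (residue R)) (𝔓 : Ideal B) [𝔓.IsPrime]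
    (hm : (maximalIdeal R).map (algebraMap R B) ≤ 𝔓) : (𝔓.map ρ).IsPrime :=
  Ideal.map_isPrime_of_surjective (reduction_surjective hρ) ((ker_reduction_le hsurj hρ).trans hm)

/-- … whose preimage is `𝔓` (the primes of `B` over `𝔪` ARE the primes of the exceptional line `κ[X]`). [folklore] -/
theorem comap_map_reduction (hsurj : Function.Surjective (Polynomial.aeval (R := R) t))
    (hρ : ∀ p : R[X], ρ (Polynomial.aeval t p) = p.map (residue R)) (𝔓 : Ideal B) [𝔓.IsPrime]
    (hm : (maximalIdeal R).map (algebraMap R B) ≤ 𝔓) : (𝔓.map ρ).comap ρ = 𝔓 := by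
  rw [Ideal.comap_map_of_surjective ρ (reduction_surjective hρ), sup_eq_left, ← RingHom.ker_eq_comap_bot]
  exact (ker_reduction_le hsurj hρ).trans hm

/-- **Orders only grow under `ρ`**: if `b ∈ (𝔓B_𝔓)^n` then `ρ(b) ∈ (𝔮 κ[X]_𝔮)^n`, `𝔮 = ρ(𝔓)` — the local map
`B_𝔓 → κ[X]_𝔮` induced by `ρ` is a local homomorphism. [folklore] -/
theorem algebraMap_reduction_mem_pow (hsurj : Function.Surjective (Polynomial.aeval (R := R) t))
    (hρ : ∀ p : R[X], ρ (Polynomial.aeval t p) = p.map (residue R)) (𝔓 : Ideal B) [𝔓.IsPrime]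
    (hm : (maximalIdeal R).map (algebraMap R B) ≤ 𝔓) [(𝔓.map ρ).IsPrime] {b : B} {n : ℕ}
    (h : algebraMap B (Localization.AtPrime 𝔓) b ∈ maximalIdeal (Localization.AtPrime 𝔓) ^ n) :
    algebraMap (ResidueField R)[X] (Localization.AtPrime (𝔓.map ρ)) (ρ b) ∈
      maximalIdeal (Localization.AtPrime (𝔓.map ρ)) ^ n := by
  have hPQ : 𝔓 = (𝔓.map ρ).comap ρ := (comap_map_reduction hsurj hρ 𝔓 hm).symm
  let ψ := Localization.localRingHom 𝔓 (𝔓.map ρ) ρ hPQ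
  have h1 := Ideal.mem_map_of_mem ψ h
  rw [Ideal.map_pow, Localization.localRingHom_to_map] at h1
  have hle : (maximalIdeal (Localization.AtPrime 𝔓)).map ψ ≤ maximalIdeal (Localization.AtPrime (𝔓.map ρ)) :=
    Ideal.map_le_iff_le_comap.mpr fun x hx => map_nonunit ψ x hx
  exact Ideal.pow_right_mono hle n h1

/-- **The rational points**: `ρ⁻¹((X − c̄)) = 𝔪B + (t − c)` for `c ∈ R` (Euclidean division by `X − c`). [folklore] -/
theorem comap_reduction_span_X_sub_C (hsurj : Function.Surjective (Polynomial.aeval (R := R) t))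
    (hρ : ∀ p : R[X], ρ (Polynomial.aeval t p) = p.map (residue R)) (c : R) :
    (Ideal.span {X - C (residue R c)}).comap ρ =
      (maximalIdeal R).map (algebraMap R B) ⊔ Ideal.span {t - algebraMap R B c} := by
  apply le_antisymm
  · intro z hz
    obtain ⟨q, rfl⟩ := hsurj z
    rw [Ideal.mem_comap, hρ, Ideal.mem_span_singleton, dvd_iff_isRoot, IsRoot.def, eval_map, eval₂_hom,
      residue_eq_zero_iff] at hz
    obtain ⟨g, hg⟩ := Polynomial.X_sub_C_dvd_sub_C_eval (p := q) (a := c)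
    have hdecomp : Polynomial.aeval t q = algebraMap R B (q.eval c) + (t - algebraMap R B c) * Polynomial.aeval t g := by
      have h := congrArg (Polynomial.aeval t) hg
      rw [map_sub, Polynomial.aeval_C, map_mul, map_sub, Polynomial.aeval_X, Polynomial.aeval_C] at h
      linear_combination h
    rw [hdecomp]
    exact Ideal.add_mem _ (Ideal.mem_sup_left (Ideal.mem_map_of_mem _ hz))
      (Ideal.mem_sup_right (Ideal.mul_mem_right _ _ (Ideal.mem_span_singleton_self _)))
  · refine sup_le ?_ ?_
    · rw [Ideal.map_le_iff_le_comap]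
      intro m hm
      rw [Ideal.mem_comap, Ideal.mem_comap, reduction_algebraMap hρ, (residue_eq_zero_iff m).mpr hm, map_zero]
      exact Ideal.zero_mem _
    · rw [Ideal.span_le, Set.singleton_subset_iff, SetLike.mem_coe, Ideal.mem_comap, map_sub, reduction_gen hρ,
        reduction_algebraMap hρ]
      exact Ideal.mem_span_singleton_self _

/-- The rational points are closed points: `𝔪B + (t − c)` is a maximal ideal of `B`. [folklore] -/
theorem isMaximal_map_sup_span_gen_sub (hsurj : Function.Surjective (Polynomial.aeval (R := R) t))
    (hρ : ∀ p : R[X], ρ (Polynomial.aeval t p) = p.map (residue R)) (c : R) :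
    ((maximalIdeal R).map (algebraMap R B) ⊔ Ideal.span {t - algebraMap R B c}).IsMaximal := by
  rw [← comap_reduction_span_X_sub_C hsurj hρ c]
  haveI : (Ideal.span ({X - C (residue R c)} : Set (ResidueField R)[X])).IsMaximal :=
    PrincipalIdealRing.isMaximal_of_irreducible (irreducible_X_sub_C _)
  exact Ideal.comap_isMaximal_of_surjective ρ (reduction_surjective hρ)

end ReductionEngine

end Summit.ResolutionOfSingularities.ResolutionOfSingularities.Cruxes.EquisingularLiftNat.Sections

end
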